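import Literature.Analysis.FluidPDE.TsaiTheoremsFromStokes
import Literature.Analysis.FluidPDE.TsaiGrowthLemmasProofs
import Literature.Analysis.FluidPDE.StokesInteriorEstimateHolds
import Literature.Analysis.FluidPDE.NormalisedPressureLpBoundProofs
import HarnessLib

/-!
# Tsai 1998, Theorem 1 (Leray profiles in `L^q(ℝ³)`, `3 < q < ∞`, vanish): the discharge

Analysis/FluidPDE proofs file (no definitions, no named facts) for the named fact
`Literature.Analysis.FluidPDE.tsai_selfsimilar` of `SelfSimilarLiouville.lean` (statement
**ns.S21**; T.-P. Tsai, *On Leray's self-similar solutions of the Navier–Stokes equations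
satisfying local energy estimates*, Arch. Rational Mech. Anal. 143 (1998) 29–51, **Theorem 1**,
p. 31: "If a weak solution `U` of (1.3) belongs to `L^q(ℝ³)` for some `q ∈ (3, ∞]`, then it must
be constant (and hence identically zero if `q < ∞`)"; the fact renders the case `3 < q < ∞` for
the tree's pointwise profile class `IsLerayProfile ν a U P`, `ν, a > 0`):

* `tsai_selfsimilar_holds : tsai_selfsimilar` — **the discharge**.

It is the accepted assembly `tsai_selfsimilar_of_stokes_facts` (`TsaiTheoremsFromStokes.lean`:
Tsai's §5 endgame `TsaiProfileEndgame` — the head pressure `Π = ½|U|² + P + a y·U` with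
Nečas–Růžička–Šverák's identity (1.7), the Liouville-type Lemma 5.1
(`isConst_of_driftOp_nonneg_of_poly`), `ΔU = 0` and the harmonic Liouville theorem in `L^q` —
fed by the growth lemmas of §3) applied to the four discharged analytic inputs of the tree:

* `tsai1998_profile_smooth_holds` (`TsaiGrowthLemmasProofs.lean`; Tsai p. 33: weak solutions of
  (1.3) are smooth — the Stokeslet representation and the bootstrap of
  `LerayProfileRegularity` / `LerayProfileRepresentation`);
* `tsai1998_lemma33_holds` (ibid.; Tsai's Lemma 3.3, p. 40: `U(y) = o(|y|)` in the averaged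
  `L²` sense (3.12) for `U ∈ L^q`, `3 < q < ∞`);
* `stokes_interior_Lr_estimate_holds` (`StokesInteriorEstimateHolds.lean`; the interior `L^r`
  estimate (3.2), p. 37, for the Stokes system ← Galdi / Cattabriga, from the tree's
  Calderón–Zygmund theory `Literature/Analysis/SingularIntegrals/`);
* `stein1970_normalisedPressure_Lp_bound_holds` (`NormalisedPressureLpBoundProofs.lean`; Stein's
  `L^p` bound for the normalised pressure `RᵢRⱼ(UᵢUⱼ)`, Tsai's Lemma 2.1 input),

the last two entering through Tsai's Lemma 3.2 (polynomial growth of the pressure,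
`tsai1998_lemma32_of_facts`, `TsaiPressureGrowth.lean`). The trust base of `tsai_selfsimilar` is
thereby Mathlib's axioms only; in particular the `L^q` conjunct (`3 < q < ∞`) of the barrier
`Literature.Barriers.NavierStokesRegularity.LeraySelfSimilarBlowupExclusion` is unconditional.
(The `L³` conjunct `necas_ruzicka_sverak` and the local-energy conjunct
`tsai_selfsimilar_local_energy` still rest on the Caffarelli–Kohn–Nirenberg one-scale criterion:
`necas_ruzicka_sverak_of_RRS_steps`, `tsai_selfsimilar_local_energy_of_stokes`.)

## References

* T.-P. Tsai, *On Leray's self-similar solutions of the Navier–Stokes equations satisfying local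
  energy estimates*, Arch. Rational Mech. Anal. 143 (1998) 29–51: Theorem 1 (p. 31), Lemma 2.1
  (p. 34), (3.2) (p. 37), Lemmas 3.2–3.3 (pp. 39–40), Lemma 5.1 and the proof of Theorems 1–2
  (pp. 47–49). [Tsai1998]
* J. Nečas, M. Růžička, V. Šverák, *On Leray's self-similar solutions of the Navier–Stokes
  equations*, Acta Math. 176 (1996) 283–294: Lemma 3.3 (p. 290), Theorem 1 (p. 291).
  [NecasRuzickaSverak1996]
-/

noncomputable section

namespace Literature.Analysis.FluidPDE

/-- **Discharge of `tsai_selfsimilar`** (Tsai 1998, Theorem 1, p. 31, case `3 < q < ∞`: a Leray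
profile `(U, P)` — `IsLerayProfile ν a U P`, `ν > 0`, `a > 0` — with `U ∈ L^q(ℝ³)` for some
`3 < q < ∞` vanishes identically). PROVED: `tsai_selfsimilar_of_stokes_facts` applied to
`tsai1998_profile_smooth_holds`, `tsai1998_lemma33_holds`, `stokes_interior_Lr_estimate_holds` and
`stein1970_normalisedPressure_Lp_bound_holds`. [cite: Tsai1998, Theorem 1 (p. 31)] -/
theorem tsai_selfsimilar_holds : tsai_selfsimilar :=
  tsai_selfsimilar_of_stokes_facts tsai1998_profile_smooth_holds tsai1998_lemma33_holds
    stokes_interior_Lr_estimate_holds stein1970_normalisedPressure_Lp_bound_holds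

end Literature.Analysis.FluidPDE

end
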